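import Mathlib.NumberTheory.Real.Irrational
import Mathlib.Algebra.Squarefree.Basic
import Mathlib.Tactic.Linarith
import Mathlib.Tactic.LinearCombination
import Mathlib.Tactic.Ring
import HarnessLib

/-!
# Venture HSemireg — the pair-block lattice of the split node-pair seed: an EVEN real polarisation `H₂` is never
# reached over an imaginary node field (ENGINE-W PROBE5 §32, THEOREM 30-J ⊇ THEOREM 30-A) — the kernel arithmetic

HONEST FRAMING. Lean index of the computation cell `pub-hsemireg`, widening group ENGINE-W (code A, seat `engine-w-1`,
gen 16). CLASS ∕ LATTICE LEVEL: integer arithmetic of one quaternary form and its hermitian companion; no abelian variety,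
no sheaf, no `Ext` group and no semiregularity map is constructed; nothing here says that HC, HC_CM or HC_AV holds, and
nothing here is a statement about any deciding row of the cell's verdicts. Theorems only (0 `def`, 0 named fact, 0 `sorry`).

SOURCE (the cell's own result, not a quotation of print): `widen/ENGINE-W/out/probe5/PROBE5-STIZ-A.md` §32 (v3.8,
2026-08-24T08:46Z; file of record v4.9k sha256∕16 `d984e355a7a98c81`), one-page card `MNEG-PAIRBLOCK-CARD-A.md` v1.5;
hand ×2 ACROSS SEATS (red-w-2 g37 RED READ, bus l.17234: LEMMA 32.1 ∕ 30-J ∕ 30-K CONCUR); machine: the tensor model ×2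
ACROSS CODES (code B `hblock_B`, TABLE-ENGINE-W row 305), LEMMA 32.1's formula 200∕200 + det `m²` on 9 cells (v3.8a).

THE SETTING (PROBE5 §29–§32; entering BY VALUE). `K = ℚ(ω)`, node field `ℚ(√m)`, `m < 0` squarefree, `m ≠ −3`,
`F = ℚ(ω, √m)`, `F⁺ = ℚ(δ)`, `δ = √−3·√m` (`δ² = −3m`). A pair block of a Weil datum carries a positive-definite REAL
binary polarisation `H₂ = [[a,b],[b,c]]` (`d = ac − b²`) and an integral oriented target `(A, N)` with `d ∣ N`, `N = N′d`,
`tN = A² − m`. PROPOSITION 30.1: the block lattice is `𝓛 = O_K² + μ·H₂⁻¹O_K²`, `μ = (A + √m)∕t`, with norm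
`𝒩(x) = t·xᵀH₂x̄ ∈ F⁺`; «the split seed reaches the block» ⟹ some `c₁ ∈ 𝓛` has `𝒩(c₁) = 1` (first column of an
orthonormal `R₀`-basis). LEMMA 32.1 (real descent): `𝓛 = M ⊕ ω·M`, `M = ℤ² + μH₂⁻¹ℤ²`; for `x = u + μH₂⁻¹y`
(`u, y ∈ ℤ²`) the norm is the integral quaternary form
  `h_M[x] = t·H₂[u] + 2A·uᵀy + N′·adj(H₂)[y]`                                    (this file: `Q`)
and the hermitian pairing is `h_M(x, x′) = a₀ + b₀√m` with
  `a₀ = t·uᵀH₂u′ + A(uᵀy′ + yᵀu′) + N′·yᵀadj(H₂)y′` (the polarisation of `h_M`)   (this file: `P`)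
  `b₀ = yᵀu′ − uᵀy′`                                                              (this file: `S`)
(the two closed forms follow from `tμ̄ = A − √m`, `tμμ̄ = N`; this seat re-derived them and LEMMA 32.1's norm formula
below in exact `ℚ(ω, √m)`-arithmetic on 1 000 random cells (916 with `t·d ≠ 0`), 0 mismatches — `widen/ENGINE-W/codeA/pairblock32_check_A.py`;
the engine-side check of the formula is PROBE5 v3.8a, 200∕200), and
  `𝒩(m₁ + ω·m₂) = h_M[m₁] + h_M[m₂] − a₀ − b₀·δ`        (`δ = (ω − ω̄)·√m`, `ω − ω̄ = √−3`).
Since `δ = √(−3m)` is irrational for squarefree `m ≠ −3` (§4 below, kernel), `𝒩(m₁ + ωm₂) = 1` reads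
`b₀ = 0 ∧ h_M[m₁] + h_M[m₂] − a₀ = 1` — two INTEGER equations. What the kernel holds:

* §1 `gram_identity` — the `2 × 2` Gram identity of the hermitian form `t·H₂` written out over `ℤ`:
  `t²d·(Q Q′ − P² + m S²) = E₀² − m·E₁²` with two explicit integer polynomials `E₀, E₁` (`= t²d·det[X X′]` split into
  its `1`- and `√m`-parts), by `ring` in any commutative ring; hence (§1b) CAUCHY–SCHWARZ `P² − m S² ≤ Q Q′` whenever
  `t ≠ 0`, `d > 0`, `m ≤ 0` — no positivity of the target is needed.
* §2 `even_normForm` — `a, c` even ⟹ `h_M` takes only EVEN values.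
* §3 `parity_core` — for even integers `s, s′` and an integer `P` with `P² ≤ s s′`: `s + s′ − P ≠ 1`
  (this replaces the card's «`≥ 2` off `0` + `(h₁+h₂−1)² > h₁h₂`» by one inequality; definiteness is NOT used).
* §4 `not_isSquare_neg_three_mul` ∕ `irrational_delta` ∕ `eq_of_sub_mul_eq_one` — `m` squarefree, `m ≠ −3` ⟹ `−3m` is not a square ⟹
  `δ` irrational ⟹ `X − b₀δ = 1` forces `b₀ = 0 ∧ X = 1` for integers `X, b₀`.
* §5 **`pairBlock_even_never`** (THEOREM 30-J, kernel form): `a ≡ c ≡ 0 (mod 2)`, `d > 0`, `t ≠ 0`, `m = A² − tN′d ≤ 0`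
  ⟹ for ALL `m₁ = (u, y)`, `m₂ = (u′, y′) ∈ ℤ⁴`: `¬ (S = 0 ∧ Q + Q′ − P = 1)`; with §4, **`pairBlock_even_norm_ne_one`**:
  `(Q + Q′ − P : ℝ) − S·√(−3m) ≠ 1` — no element of `M ⊕ ωM` has norm `1`. §5b **`pairBlock_H212_never`**: the case
  `H₂ = [[2,1],[1,2]]` (THEOREM 30-A: «the seed NEVER reaches a `[[2,1],[1,2]]`-block — every imaginary node field, every
  integral oriented target»), for which `t ≠ 0` and `m = A² − 3tN′ ≤ 0` are the only hypotheses left.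
WHAT IS NOT HERE: the model facts PROPOSITION 30.1 ∕ LEMMA 32.1 themselves (engine-read, ×2 across codes), THEOREM 30-K
(odd diagonal ⟹ reached over `ℚ(√−2)`: Korkine–Zolotarev `γ₄ = √2` + THEOREM 30-F), the non-real `H₂` (no `c`-descent).
-/

namespace Summit.Ventures.HSemireg.PairBlock

/-! ## §1 The Gram identity of the hermitian pair-block form, over `ℤ` (any commutative ring) -/

/-- **Gram identity** (PROBE5 §32 ∕ §31 (α)): for the hermitian form `t·H₂` on `F²` and `X = u + μH₂⁻¹y`,
`X′ = u′ + μH₂⁻¹y′`, `h[X]h[X′] − |h(X,X′)|² = det(tH₂)·|det[X X′]|²`; multiplied by `t²d` and split into `1`- and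
`√m`-parts (`μ = (A+√m)∕t`, `μ² = (A² + m + 2A√m)∕t²`, `H₂⁻¹ = adj(H₂)∕d`) it is the integer polynomial identity
`t²d·(Q·Q′ − P² + m·S²) = E₀² − m·E₁²` below (all twelve quantities given by their closed forms). [kernel, `ring`] -/
theorem gram_identity {R : Type*} [CommRing R]
    (a b c t A N' u₁ u₂ y₁ y₂ u₁' u₂' y₁' y₂' d m Q Q' P S E₀ E₁ : R)
    (hd : d = a * c - b ^ 2) (hm : m = A ^ 2 - t * N' * d)
    (hQ : Q = t * (a * u₁ ^ 2 + 2 * b * u₁ * u₂ + c * u₂ ^ 2) + 2 * A * (u₁ * y₁ + u₂ * y₂)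
        + N' * (c * y₁ ^ 2 - 2 * b * y₁ * y₂ + a * y₂ ^ 2))
    (hQ' : Q' = t * (a * u₁' ^ 2 + 2 * b * u₁' * u₂' + c * u₂' ^ 2) + 2 * A * (u₁' * y₁' + u₂' * y₂')
        + N' * (c * y₁' ^ 2 - 2 * b * y₁' * y₂' + a * y₂' ^ 2))
    (hP : P = t * (a * u₁ * u₁' + b * (u₁ * u₂' + u₂ * u₁') + c * u₂ * u₂')
        + A * (u₁ * y₁' + u₂ * y₂' + y₁ * u₁' + y₂ * u₂')
        + N' * (c * y₁ * y₁' - b * (y₁ * y₂' + y₂ * y₁') + a * y₂ * y₂'))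
    (hS : S = y₁ * u₁' + y₂ * u₂' - u₁ * y₁' - u₂ * y₂')
    (hE₀ : E₀ = t ^ 2 * d * (u₁ * u₂' - u₂ * u₁')
        + t * A * ((u₁ * (-b * y₁' + a * y₂') - u₂ * (c * y₁' - b * y₂'))
                   + ((c * y₁ - b * y₂) * u₂' - (-b * y₁ + a * y₂) * u₁'))
        + (A ^ 2 + m) * (y₁ * y₂' - y₂ * y₁'))
    (hE₁ : E₁ = t * ((u₁ * (-b * y₁' + a * y₂') - u₂ * (c * y₁' - b * y₂'))
                   + ((c * y₁ - b * y₂) * u₂' - (-b * y₁ + a * y₂) * u₁'))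
        + 2 * A * (y₁ * y₂' - y₂ * y₁')) :
    t ^ 2 * d * (Q * Q' - P ^ 2 + m * S ^ 2) = E₀ ^ 2 - m * E₁ ^ 2 := by
  subst hE₀ hE₁ hS hP hQ hQ' hm hd
  ring

/-- `P` is the polarisation of `Q`: on the diagonal `x′ = x` it returns `h_M[x]`. [kernel, `ring`] -/
theorem polar_self {R : Type*} [CommRing R] (a b c t A N' u₁ u₂ y₁ y₂ : R) :
    t * (a * u₁ * u₁ + b * (u₁ * u₂ + u₂ * u₁) + c * u₂ * u₂) + A * (u₁ * y₁ + u₂ * y₂ + y₁ * u₁ + y₂ * u₂)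
        + N' * (c * y₁ * y₁ - b * (y₁ * y₂ + y₂ * y₁) + a * y₂ * y₂)
      = t * (a * u₁ ^ 2 + 2 * b * u₁ * u₂ + c * u₂ ^ 2) + 2 * A * (u₁ * y₁ + u₂ * y₂)
        + N' * (c * y₁ ^ 2 - 2 * b * y₁ * y₂ + a * y₂ ^ 2) := by
  ring

/-- `S` (the `√m`-part of the hermitian pairing) is alternating: it vanishes on the diagonal, so `h_M[x] = 𝒩(x) ∈ ℤ` on `M`
(«the `δ`-part vanishes on `M`», PROBE5 §32 (3)(ii)). [kernel, `ring`] -/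
theorem skew_self {R : Type*} [CommRing R] (u₁ u₂ y₁ y₂ : R) :
    y₁ * u₁ + y₂ * u₂ - u₁ * y₁ - u₂ * y₂ = 0 := by
  ring

/-- From a Gram identity `T·X = E₀² − m·E₁²` with `T > 0` and `m ≤ 0`, the quantity `X` is non-negative. [kernel] -/
theorem nonneg_of_gram {T X m E₀ E₁ : ℤ} (hT : 0 < T) (hm : m ≤ 0) (key : T * X = E₀ ^ 2 - m * E₁ ^ 2) :
    0 ≤ X := by
  have h1 : 0 ≤ E₀ ^ 2 - m * E₁ ^ 2 := by nlinarith [sq_nonneg E₀, sq_nonneg E₁]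
  by_contra h
  push Not at h
  have : T * X < 0 := mul_neg_of_pos_of_neg hT h
  linarith

/-- **Cauchy–Schwarz for the pair-block hermitian form** (the step «`a₀² + |m|b₀² = |z|² ≤ h_M[m₁]·h_M[m₂]`» of
THEOREM 30-J's proof), from `gram_identity`: if `t ≠ 0`, `d = ac − b² > 0` and `m = A² − tN′d ≤ 0` then
`P² − m·S² ≤ Q·Q′`. Positivity of the target (`N > 0`) is not needed. [kernel] -/
theorem cauchySchwarz (a b c t A N' u₁ u₂ y₁ y₂ u₁' u₂' y₁' y₂' d m Q Q' P S : ℤ)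
    (hd : d = a * c - b ^ 2) (hm : m = A ^ 2 - t * N' * d)
    (hQ : Q = t * (a * u₁ ^ 2 + 2 * b * u₁ * u₂ + c * u₂ ^ 2) + 2 * A * (u₁ * y₁ + u₂ * y₂)
        + N' * (c * y₁ ^ 2 - 2 * b * y₁ * y₂ + a * y₂ ^ 2))
    (hQ' : Q' = t * (a * u₁' ^ 2 + 2 * b * u₁' * u₂' + c * u₂' ^ 2) + 2 * A * (u₁' * y₁' + u₂' * y₂')
        + N' * (c * y₁' ^ 2 - 2 * b * y₁' * y₂' + a * y₂' ^ 2))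
    (hP : P = t * (a * u₁ * u₁' + b * (u₁ * u₂' + u₂ * u₁') + c * u₂ * u₂')
        + A * (u₁ * y₁' + u₂ * y₂' + y₁ * u₁' + y₂ * u₂')
        + N' * (c * y₁ * y₁' - b * (y₁ * y₂' + y₂ * y₁') + a * y₂ * y₂'))
    (hS : S = y₁ * u₁' + y₂ * u₂' - u₁ * y₁' - u₂ * y₂')
    (ht : t ≠ 0) (hdpos : 0 < d) (hmle : m ≤ 0) :
    P ^ 2 - m * S ^ 2 ≤ Q * Q' := by
  have key := gram_identity a b c t A N' u₁ u₂ y₁ y₂ u₁' u₂' y₁' y₂' d m Q Q' P S _ _ hd hm hQ hQ' hP hS rfl rfl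
  have hT : 0 < t ^ 2 * d := mul_pos (by positivity) hdpos
  have hX := nonneg_of_gram hT hmle key
  linarith

/-! ## §2 Parity: an even polarisation gives an even quaternary form -/

/-- **`h_M` is even-valued when `a ≡ c ≡ 0 (mod 2)`** («`H₂[u] = au₁² + 2bu₁u₂ + cu₂²` and `adj(H₂)[y] = cy₁² − 2by₁y₂ + ay₂²`
are even, `t, N∕d ∈ ℤ`, so `h_M` takes only EVEN values on `M`», PROBE5 §32 (2)). [kernel] -/
theorem even_normForm (a b c t A N' u₁ u₂ y₁ y₂ Q : ℤ) (ha : Even a) (hc : Even c)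
    (hQ : Q = t * (a * u₁ ^ 2 + 2 * b * u₁ * u₂ + c * u₂ ^ 2) + 2 * A * (u₁ * y₁ + u₂ * y₂)
        + N' * (c * y₁ ^ 2 - 2 * b * y₁ * y₂ + a * y₂ ^ 2)) : Even Q := by
  obtain ⟨a', rfl⟩ := ha
  obtain ⟨c', rfl⟩ := hc
  subst hQ
  exact ⟨t * (a' * u₁ ^ 2 + b * u₁ * u₂ + c' * u₂ ^ 2) + A * (u₁ * y₁ + u₂ * y₂)
        + N' * (c' * y₁ ^ 2 - b * y₁ * y₂ + a' * y₂ ^ 2), by ring⟩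

/-! ## §3 The arithmetic core: even values cannot glue to norm one under Cauchy–Schwarz -/

/-- **Parity core of THEOREM 30-J.** If `s, s′` are even integers and `P² ≤ s·s′` then `s + s′ − P ≠ 1`. (From `4ss′ ≤ (s+s′)²`
one gets `3P² ≤ 2P + 1`, so `P ∈ {0, 1}`; `P = 0` contradicts parity, `P = 1` forces `s + s′ = 2 ∧ ss′ ≥ 1`, impossible for
even `s, s′`.) This one inequality replaces the card's «values `≥ 2` off `0`» + «`(h₁+h₂−1)² > h₁h₂`»: definiteness of `h_M`
is not used. [kernel] -/
theorem parity_core (s s' P : ℤ) (hs : Even s) (hs' : Even s') (hcs : P ^ 2 ≤ s * s') : s + s' - P ≠ 1 := by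
  intro h1
  obtain ⟨p, hp⟩ := hs
  obtain ⟨q, hq⟩ := hs'
  have hsum : s + s' = P + 1 := by linarith
  have h4 : 4 * (s * s') ≤ (s + s') ^ 2 := by nlinarith [sq_nonneg (s - s')]
  rw [hsum] at h4
  have key : 3 * P ^ 2 ≤ 2 * P + 1 := by nlinarith
  have hP : P = 0 ∨ P = 1 := by
    rcases le_or_gt P (-1) with h | h
    · exfalso
      nlinarith [mul_nonneg (show (0:ℤ) ≤ -1 - P by linarith) (show (0:ℤ) ≤ -1 - P by linarith)]
    · rcases le_or_gt P 1 with h' | h'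
      · omega
      · exfalso
        nlinarith [mul_nonneg (show (0:ℤ) ≤ P - 2 by linarith) (show (0:ℤ) ≤ P by linarith)]
  rcases hP with rfl | rfl
  · -- `s + s' = 1` with `s, s'` even
    omega
  · -- `s + s' = 2`, `1 ≤ s s'`, `s = 2p`, `s' = 2q`
    have hpq : p + q = 1 := by omega
    have hq' : q = 1 - p := by omega
    subst hq'
    have h1le : 1 ≤ (p + p) * ((1 - p) + (1 - p)) := by rw [← hp, ← hq]; simpa using hcs
    rcases le_or_gt p 0 with h0 | h0
    · nlinarith [mul_nonneg (show (0:ℤ) ≤ -p by linarith) (show (0:ℤ) ≤ 1 - p by linarith)]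
    · nlinarith [mul_nonneg (show (0:ℤ) ≤ p - 1 by linarith) (show (0:ℤ) ≤ p by linarith)]

/-! ## §4 `δ = √(−3m)` is irrational for squarefree `m ≠ −3`: «`𝒩 = 1`» is two integer equations -/

/-- For a squarefree integer `m` with `m ≠ −3`, `−3m` is not a perfect square: if `−3m = k²` then `3 ∣ k`,
`m = −3j²`, and squarefreeness forces `j = ±1`. (The cell's standing hypothesis «`m` squarefree, `m ≠ −3`» of §29–§32 is
exactly what makes `F⁺ = ℚ(δ)`, `δ² = −3m`, a quadratic field.) [kernel] -/
theorem not_isSquare_neg_three_mul (m : ℤ) (hsq : Squarefree m) (h3 : m ≠ -3) :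
    ¬ IsSquare (-3 * m) := by
  rintro ⟨k, hk⟩
  have h3k : (3 : ℤ) ∣ k * k := ⟨-m, by linarith⟩
  have h3k' : (3 : ℤ) ∣ k := (Int.prime_three.dvd_mul.1 h3k).elim id id
  obtain ⟨j, rfl⟩ := h3k'
  have hm : m = -3 * (j * j) := by linarith
  have hj : j * j ∣ m := ⟨-3, by rw [hm]; ring⟩
  have hunit : IsUnit j := hsq j hj
  rcases Int.isUnit_iff.1 hunit with rfl | rfl
  · exact h3 (by norm_num [hm])
  · exact h3 (by norm_num [hm])

/-- Hence `δ = √(−3m)` is irrational (`m < 0` squarefree, `m ≠ −3`). [kernel; Mathlib `irrational_sqrt_intCast_iff_of_nonneg`] -/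
theorem irrational_delta (m : ℤ) (hm : m < 0) (hsq : Squarefree m) (h3 : m ≠ -3) :
    Irrational (Real.sqrt ((-3 * m : ℤ) : ℝ)) := by
  rw [irrational_sqrt_intCast_iff_of_nonneg (by linarith)]
  exact not_isSquare_neg_three_mul m hsq h3

/-- In `F⁺ = ℚ(δ)` the equation `X − b₀·δ = 1` with `X, b₀ ∈ ℤ` and `δ` irrational forces `b₀ = 0` and `X = 1`
(«`𝒩(c₁) = 1` forces `b₀ = 0` and `a₀ = h_M[m₁] + h_M[m₂] − 1`»). [kernel] -/
theorem eq_of_sub_mul_eq_one {δ : ℝ} (hδ : Irrational δ) (X b₀ : ℤ) (h : (X : ℝ) - b₀ * δ = 1) :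
    b₀ = 0 ∧ X = 1 := by
  by_cases hb : b₀ = 0
  · subst hb
    refine ⟨rfl, ?_⟩
    have : (X : ℝ) = 1 := by simpa using h
    exact_mod_cast this
  · exfalso
    have hb' : (b₀ : ℝ) ≠ 0 := by exact_mod_cast hb
    have hδeq : δ = ((X - 1 : ℤ) : ℝ) / (b₀ : ℝ) := by
      field_simp
      push_cast
      linarith
    apply hδ
    refine ⟨((X - 1 : ℤ) : ℚ) / (b₀ : ℚ), ?_⟩
    rw [hδeq]
    push_cast
    rfl

/-! ## §5 THEOREM 30-J (kernel form) and THEOREM 30-A -/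

/-- **THEOREM 30-J — kernel form** (PROBE5 §32 (2): «if `a ≡ c ≡ 0 (mod 2)` then the split seed does not reach
`Λ_X(H₂; A, N)` at any integral oriented target of any imaginary node field»). In the real descent `𝓛 = M ⊕ ωM`
(LEMMA 32.1, by value) an element `c₁ = m₁ + ω·m₂`, `m₁ = (u, y)`, `m₂ = (u′, y′) ∈ ℤ⁴`, has norm
`𝒩(c₁) = Q + Q′ − P − S·δ`; the kernel statement is that the two integer equations `S = 0`, `Q + Q′ − P = 1` of
«`𝒩(c₁) = 1`» have NO solution, for every `(u, y, u′, y′) ∈ ℤ⁸`, whenever `a, c` are even, `d = ac − b² > 0`, `t ≠ 0`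
and `m = A² − tN′d ≤ 0`. (The degenerate cases `m₂ = 0` ∕ `m₁ = 0` of the card's proof are the instances `u′ = y′ = 0` ∕
`u = y = 0`.) Proof: §2 (`Q, Q′` even) + §1b (Cauchy–Schwarz, `S = 0` ⟹ `P² ≤ QQ′`) + §3. [kernel] -/
theorem pairBlock_even_never (a b c t A N' u₁ u₂ y₁ y₂ u₁' u₂' y₁' y₂' d m Q Q' P S : ℤ)
    (hd : d = a * c - b ^ 2) (hm : m = A ^ 2 - t * N' * d)
    (hQ : Q = t * (a * u₁ ^ 2 + 2 * b * u₁ * u₂ + c * u₂ ^ 2) + 2 * A * (u₁ * y₁ + u₂ * y₂)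
        + N' * (c * y₁ ^ 2 - 2 * b * y₁ * y₂ + a * y₂ ^ 2))
    (hQ' : Q' = t * (a * u₁' ^ 2 + 2 * b * u₁' * u₂' + c * u₂' ^ 2) + 2 * A * (u₁' * y₁' + u₂' * y₂')
        + N' * (c * y₁' ^ 2 - 2 * b * y₁' * y₂' + a * y₂' ^ 2))
    (hP : P = t * (a * u₁ * u₁' + b * (u₁ * u₂' + u₂ * u₁') + c * u₂ * u₂')
        + A * (u₁ * y₁' + u₂ * y₂' + y₁ * u₁' + y₂ * u₂')
        + N' * (c * y₁ * y₁' - b * (y₁ * y₂' + y₂ * y₁') + a * y₂ * y₂'))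
    (hS : S = y₁ * u₁' + y₂ * u₂' - u₁ * y₁' - u₂ * y₂')
    (ha : Even a) (hc : Even c) (hdpos : 0 < d) (ht : t ≠ 0) (hmle : m ≤ 0) :
    ¬ (S = 0 ∧ Q + Q' - P = 1) := by
  rintro ⟨hS0, h1⟩
  have hcs := cauchySchwarz a b c t A N' u₁ u₂ y₁ y₂ u₁' u₂' y₁' y₂' d m Q Q' P S hd hm hQ hQ' hP hS ht hdpos hmle
  rw [hS0] at hcs
  have hcs' : P ^ 2 ≤ Q * Q' := by simpa using hcs
  exact parity_core Q Q' P (even_normForm a b c t A N' u₁ u₂ y₁ y₂ Q ha hc hQ)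
    (even_normForm a b c t A N' u₁' u₂' y₁' y₂' Q' ha hc hQ') hcs' h1

/-- **THEOREM 30-J with the irrationality step in the kernel**: under the same hypotheses and `m < 0` squarefree,
`m ≠ −3`, the real number `𝒩(m₁ + ωm₂) = (Q + Q′ − P) − S·√(−3m)` is `≠ 1` for every `(u, y, u′, y′) ∈ ℤ⁸` — no element
of `M ⊕ ωM` has norm one, so (by PROPOSITION 30.1 ∕ LEMMA 32.1, by value) the split seed never reaches an even real
`H₂`-block. [kernel] -/
theorem pairBlock_even_norm_ne_one (a b c t A N' u₁ u₂ y₁ y₂ u₁' u₂' y₁' y₂' d m Q Q' P S : ℤ)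
    (hd : d = a * c - b ^ 2) (hm : m = A ^ 2 - t * N' * d)
    (hQ : Q = t * (a * u₁ ^ 2 + 2 * b * u₁ * u₂ + c * u₂ ^ 2) + 2 * A * (u₁ * y₁ + u₂ * y₂)
        + N' * (c * y₁ ^ 2 - 2 * b * y₁ * y₂ + a * y₂ ^ 2))
    (hQ' : Q' = t * (a * u₁' ^ 2 + 2 * b * u₁' * u₂' + c * u₂' ^ 2) + 2 * A * (u₁' * y₁' + u₂' * y₂')
        + N' * (c * y₁' ^ 2 - 2 * b * y₁' * y₂' + a * y₂' ^ 2))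
    (hP : P = t * (a * u₁ * u₁' + b * (u₁ * u₂' + u₂ * u₁') + c * u₂ * u₂')
        + A * (u₁ * y₁' + u₂ * y₂' + y₁ * u₁' + y₂ * u₂')
        + N' * (c * y₁ * y₁' - b * (y₁ * y₂' + y₂ * y₁') + a * y₂ * y₂'))
    (hS : S = y₁ * u₁' + y₂ * u₂' - u₁ * y₁' - u₂ * y₂')
    (ha : Even a) (hc : Even c) (hdpos : 0 < d) (ht : t ≠ 0)
    (hmneg : m < 0) (hsq : Squarefree m) (h3 : m ≠ -3) :
    ((Q + Q' - P : ℤ) : ℝ) - (S : ℝ) * Real.sqrt ((-3 * m : ℤ) : ℝ) ≠ 1 := by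
  intro h
  have hb := eq_of_sub_mul_eq_one (irrational_delta m hmneg hsq h3) (Q + Q' - P) S h
  exact pairBlock_even_never a b c t A N' u₁ u₂ y₁ y₂ u₁' u₂' y₁' y₂' d m Q Q' P S hd hm hQ hQ' hP hS ha hc hdpos ht
    hmneg.le ⟨hb.1, hb.2⟩

/-- **THEOREM 30-A — kernel form** (PROBE5 §30 (3) ∕ card: «`H₂ = [[2,1],[1,2]]`, `det 3 < 4|m|` always: NO admissible
first column, the seed NEVER reaches a `[[2,1],[1,2]]`-block — every imaginary node field, every integral oriented
target»): the case `a = c = 2`, `b = 1` (`d = 3`) of `pairBlock_even_never`; the only hypotheses left are `t ≠ 0` and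
`m = A² − 3tN′ ≤ 0`. [kernel] -/
theorem pairBlock_H212_never (t A N' u₁ u₂ y₁ y₂ u₁' u₂' y₁' y₂' : ℤ) (ht : t ≠ 0)
    (hmle : A ^ 2 - t * N' * 3 ≤ 0) :
    ¬ ((y₁ * u₁' + y₂ * u₂' - u₁ * y₁' - u₂ * y₂' = 0) ∧
       (t * (2 * u₁ ^ 2 + 2 * 1 * u₁ * u₂ + 2 * u₂ ^ 2) + 2 * A * (u₁ * y₁ + u₂ * y₂)
          + N' * (2 * y₁ ^ 2 - 2 * 1 * y₁ * y₂ + 2 * y₂ ^ 2))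
        + (t * (2 * u₁' ^ 2 + 2 * 1 * u₁' * u₂' + 2 * u₂' ^ 2) + 2 * A * (u₁' * y₁' + u₂' * y₂')
          + N' * (2 * y₁' ^ 2 - 2 * 1 * y₁' * y₂' + 2 * y₂' ^ 2))
        - (t * (2 * u₁ * u₁' + 1 * (u₁ * u₂' + u₂ * u₁') + 2 * u₂ * u₂')
          + A * (u₁ * y₁' + u₂ * y₂' + y₁ * u₁' + y₂ * u₂')
          + N' * (2 * y₁ * y₁' - 1 * (y₁ * y₂' + y₂ * y₁') + 2 * y₂ * y₂')) = 1) :=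
  pairBlock_even_never 2 1 2 t A N' u₁ u₂ y₁ y₂ u₁' u₂' y₁' y₂' 3 (A ^ 2 - t * N' * 3) _ _ _ _
    (by norm_num) rfl rfl rfl rfl rfl ⟨1, rfl⟩ ⟨1, rfl⟩ (by norm_num) ht hmle

end Summit.Ventures.HSemireg.PairBlock
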